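import Mathlib
import Summits.NavierStokesRegularity.NavierStokesRegularity.Theorems.EulerZoomLiouvillePowerGaugeEulerLiouvilleSelfSimilarKelvinFlow
import HarnessLib

/-!
# Rung C1 of the crux `EulerZoomLiouville.PowerGaugeEulerLiouville`: the self-similar CAUCHY FORMULA along the
# Lagrangian flow and the SOURCE EXCLUSION — in the window, vorticity cannot survive on a backward orbit along
# which the (adapted) stretching of `DW` stays below `1 + γ`
# (route №10, item stmt-NavierStokesRegularity-19832; `--supports`)

Helper file (theorems only). Seat ns-typeII-p3 (cell ns-regularity-ideate §B, D-0081).  Rung C1 (exactly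
self-similar members), the lead's open stub `stub_selfSimilarExtremal`; KEEP-1 of the crux idea «hyperbolic-stagnation
exclusion» (HOME/ns-typeII-p3/IDEA-hyperbolic-stagnation-exclusion.md, evidence #41 on the item).  PROFILE LEVEL,
classical: `(V, P)` with `IsSelfSimilarEulerProfile γ 0 V P` (CIV 2026 (3.3)), `V` smooth with `‖DV‖ ≤ K`; `Φ_s` the
self-similar Lagrangian flow of `W = γy + V` (lead's `…SelfSimilarKelvinFlow`), `Ω = curl V`.

* `cauchy_formula_flow` — **the self-similar Cauchy formula** (CIV 2026 (3.23)–(3.24), Lagrangian form of the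
  vorticity profile equation (3.4) `Ω + (W·∇)Ω = (Ω·∇)V`): for all `s ∈ ℝ`,
  `DΦ_s(y) Ω(y) = e^{(1+γ)s} Ω(Φ_s y)` (both sides solve `X' = DW(Φ_s y) X`, `X(0) = Ω(y)`; uniqueness);
* `curl_eq_zero_of_backward_orbit_stretching_lt` — **SOURCE EXCLUSION (Lagrangian, adapted metric)**: let `G` be a
  symmetric, positive definite matrix (an adapted inner product) and `R` a bounded set on which the `G`-stretching
  of `DW = γI + DV` is at most `Λ' < 1 + γ`, `⟪G DW(z)h, h⟫ ≤ Λ'⟪Gh, h⟫`.  If the BACKWARD orbit `Φ_s y`, `s ≤ 0`,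
  stays in `R`, then `Ω(y) = 0`.  Mechanism: `m(s) = ⟪G DΦ_s(y)Ω(y), DΦ_s(y)Ω(y)⟫` has `m' ≤ 2Λ' m`, so backward
  `m(s) ≥ e^{2Λ's} m(0)`, while the Cauchy formula gives `m(s) = e^{2(1+γ)s}⟪GΩ(Φ_s y), Ω(Φ_s y)⟫ ≤ C e^{2(1+γ)s}`;
  `Λ' < 1+γ` and `s → −∞` force `Ω(y) = 0`.

WHY THIS MATTERS (the idea card): at a HYPERBOLIC SOURCE `y*` of `W` (all eigenvalues of `DW(y*)` with positive real
part) the trace identity `tr DW = 3γ` gives `max Re λ < 3γ < 1 + γ` exactly in the window `γ < ½`, so an adapted `G`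
with `Λ' < 1+γ` on a neighbourhood ALWAYS exists and backward orbits from that neighbourhood stay in it: vorticity
vanishes near every hyperbolic source — with no outgoing / stretching / analyticity hypothesis (compare CIV Thm 3.8,
Prop 3.9, Thm 3.10 and the tree's p525703/p528424, all phrased with the SYMMETRIC part at ALL nodes).  With
`G = 1` the hypothesis is «stretching `sym DV ≤ Λ' − γ < 1` along the backward orbit».

WHAT THIS IS NOT: not NS, not E, not rung C1 — a conditional local exclusion for CLASSICAL profiles; the global step
(a.e. backward orbit ends at a source when the stagnation set is finite and hyperbolic) is the idea card's KEEP-2.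
[folklore; cf. ConstantinIgnatovaVicol2026Putative §3.4.1 (3.23)–(3.24), §3.5 Thm 3.8]
-/

noncomputable section

-- flat `Theorems/<Route><Decl>…` files of one crux share the namespace of the crux (tree convention)
set_option linter.dupNamespace false

open MeasureTheory Set Filter Topology Metric Function InnerProductSpace
open scoped RealInnerProductSpace NNReal ContDiff

namespace Summit.NavierStokesRegularity.NavierStokesRegularity.Theorems.PowerGaugeEulerLiouville.Kelvin

open Literature.Analysis Literature.Analysis.FluidPDE

variable {γ : ℝ} {V : EuclideanSpace ℝ (Fin 3) → EuclideanSpace ℝ (Fin 3)} {P : EuclideanSpace ℝ (Fin 3) → ℝ}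

/-! ### The self-similar Cauchy formula along the flow -/

/-- The vorticity along a trajectory: `d/ds Ω(Φ_s y) = DV(Φ_s y) Ω(Φ_s y) − Ω(Φ_s y)` (CIV (3.4) composed with
the flow). [cite: ConstantinIgnatovaVicol2026Putative, §3.1.1 eq. (3.4)] -/
theorem hasDerivAt_curl_flow (hV : ContDiff ℝ ∞ V) {K : ℝ} (hK : ∀ y, ‖fderiv ℝ V y‖ ≤ K)
    (hprof : IsSelfSimilarEulerProfile γ 0 V P) (s : ℝ) (y : EuclideanSpace ℝ (Fin 3)) :
    HasDerivAt (fun r => curl V (ODE.evolutionMap (fun _ : ℝ => selfSimilarTransport γ 0 V) 0 r y))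
      (fderiv ℝ V (ODE.evolutionMap (fun _ : ℝ => selfSimilarTransport γ 0 V) 0 s y)
          (curl V (ODE.evolutionMap (fun _ : ℝ => selfSimilarTransport γ 0 V) 0 s y)) -
        curl V (ODE.evolutionMap (fun _ : ℝ => selfSimilarTransport γ 0 V) 0 s y)) s := by
  have hV2 : ContDiff ℝ 2 V := hV.of_le (by norm_cast)
  have hcurl : Differentiable ℝ (curl V) := differentiable_curl_of_contDiff hV2
  have h1 := (hcurl (ODE.evolutionMap (fun _ : ℝ => selfSimilarTransport γ 0 V) 0 s y)).hasFDerivAt.comp_hasDerivAt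
    s (hasDerivAt_flow hV hK s y)
  have hvort := (hprof.isSelfSimilarEulerVorticityProfile).vorticity_eq
    (ODE.evolutionMap (fun _ : ℝ => selfSimilarTransport γ 0 V) 0 s y)
  rw [← selfSimilarTransport_apply] at hvort
  have e : fderiv ℝ (curl V) (ODE.evolutionMap (fun _ : ℝ => selfSimilarTransport γ 0 V) 0 s y)
      (selfSimilarTransport γ 0 V (ODE.evolutionMap (fun _ : ℝ => selfSimilarTransport γ 0 V) 0 s y)) =
      fderiv ℝ V (ODE.evolutionMap (fun _ : ℝ => selfSimilarTransport γ 0 V) 0 s y)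
          (curl V (ODE.evolutionMap (fun _ : ℝ => selfSimilarTransport γ 0 V) 0 s y)) -
        curl V (ODE.evolutionMap (fun _ : ℝ => selfSimilarTransport γ 0 V) 0 s y) := by
    rw [← hvort]; abel
  rw [e] at h1
  exact h1

/-- **The self-similar Cauchy formula.** For a classical profile (`V` smooth, `‖DV‖ ≤ K`) and every `s`, `y`:
`DΦ_s(y) Ω(y) = e^{(1+γ)s} Ω(Φ_s y)`, `Ω = curl V` — both sides solve the linear ODE `X' = (γI + DV(Φ_s y)) X` with
`X(0) = Ω(y)` (variational equation; vorticity profile equation (3.4)), and solutions are unique.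
[cite: ConstantinIgnatovaVicol2026Putative, §3.4.1 eq. (3.23)–(3.24)] -/
theorem cauchy_formula_flow (hV : ContDiff ℝ ∞ V) {K : ℝ} (hK : ∀ y, ‖fderiv ℝ V y‖ ≤ K)
    (hprof : IsSelfSimilarEulerProfile γ 0 V P) (y : EuclideanSpace ℝ (Fin 3)) (s : ℝ) :
    fderiv ℝ (ODE.evolutionMap (fun _ : ℝ => selfSimilarTransport γ 0 V) 0 s) y (curl V y) =
      Real.exp ((1 + γ) * s) • curl V (ODE.evolutionMap (fun _ : ℝ => selfSimilarTransport γ 0 V) 0 s y) := by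
  have hK0 : 0 ≤ K := (norm_nonneg _).trans (hK 0)
  -- the linear field `A(t) x = (γ I + DV(Φ_t y)) x`
  set A : ℝ → (EuclideanSpace ℝ (Fin 3) →L[ℝ] EuclideanSpace ℝ (Fin 3)) := fun t =>
    γ • ContinuousLinearMap.id ℝ (EuclideanSpace ℝ (Fin 3)) +
      fderiv ℝ V (ODE.evolutionMap (fun _ : ℝ => selfSimilarTransport γ 0 V) 0 t y) with hA
  have hlip : ∀ t, LipschitzOnWith (|γ| + K).toNNReal (fun x => A t x) univ := by
    intro t
    refine ((A t).lipschitz.weaken ?_).lipschitzOnWith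
    rw [← NNReal.coe_le_coe, coe_nnnorm, Real.coe_toNNReal _ (by positivity)]
    calc ‖A t‖ ≤ ‖γ • ContinuousLinearMap.id ℝ (EuclideanSpace ℝ (Fin 3))‖ + ‖fderiv ℝ V _‖ := norm_add_le _ _
      _ ≤ |γ| + K := by
          refine add_le_add ?_ (hK _)
          rw [norm_smul, Real.norm_eq_abs]
          exact mul_le_of_le_one_right (abs_nonneg γ) ContinuousLinearMap.norm_id_le
  -- the left-hand side solves it
  set f : ℝ → EuclideanSpace ℝ (Fin 3) := fun r =>
    fderiv ℝ (ODE.evolutionMap (fun _ : ℝ => selfSimilarTransport γ 0 V) 0 r) y (curl V y) with hf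
  have hf' : ∀ t, HasDerivAt f (A t (f t)) t ∧ f t ∈ (univ : Set (EuclideanSpace ℝ (Fin 3))) := by
    intro t
    refine ⟨?_, mem_univ _⟩
    have h1 := (hasDerivAt_fderiv_flow (γ := γ) hV hK t y).clm_apply (hasDerivAt_const t (curl V y))
    simp only [map_zero, add_zero, ContinuousLinearMap.comp_apply] at h1
    exact h1
  -- the right-hand side solves it
  set g : ℝ → EuclideanSpace ℝ (Fin 3) := fun r =>
    Real.exp ((1 + γ) * r) • curl V (ODE.evolutionMap (fun _ : ℝ => selfSimilarTransport γ 0 V) 0 r y) with hg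
  have hg' : ∀ t, HasDerivAt g (A t (g t)) t ∧ g t ∈ (univ : Set (EuclideanSpace ℝ (Fin 3))) := by
    intro t
    refine ⟨?_, mem_univ _⟩
    have hexp : HasDerivAt (fun r => Real.exp ((1 + γ) * r)) (Real.exp ((1 + γ) * t) * (1 + γ)) t := by
      simpa using ((hasDerivAt_id t).const_mul (1 + γ)).exp
    have h1 := hexp.smul (hasDerivAt_curl_flow hV hK hprof t y)
    refine h1.congr_deriv ?_
    simp only [hA, hg, _root_.add_apply, _root_.smul_apply, ContinuousLinearMap.id_apply, map_smul, smul_sub]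
    module
  have hΦ0 : ODE.evolutionMap (fun _ : ℝ => selfSimilarTransport γ 0 V) 0 0 = id :=
    funext (ODE.evolutionMap_self _ 0)
  have heq : f 0 = g 0 := by
    simp only [hf, hg, mul_zero, Real.exp_zero, one_smul, hΦ0, fderiv_id, ContinuousLinearMap.coe_id', id_eq]
  have := ODE_solution_unique_univ (v := fun t x => A t x) (s := fun _ => univ) hlip hf' hg' heq
  exact congrFun this s

/-! ### Source exclusion along a backward orbit -/

/-- Derivative of an adapted quadratic form along a curve: for `G` symmetric,
`d/ds ⟪G f(s), f(s)⟫ = 2⟪G f'(s), f(s)⟫`. [folklore] -/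
theorem hasDerivAt_adapted_sq {G : EuclideanSpace ℝ (Fin 3) →L[ℝ] EuclideanSpace ℝ (Fin 3)}
    (hGsym : ∀ u v : EuclideanSpace ℝ (Fin 3), ⟪G u, v⟫ = ⟪u, G v⟫) {f : ℝ → EuclideanSpace ℝ (Fin 3)}
    {f' : EuclideanSpace ℝ (Fin 3)} {s : ℝ} (hf : HasDerivAt f f' s) :
    HasDerivAt (fun r => ⟪G (f r), f r⟫) (2 * ⟪G f', f s⟫) s := by
  have hGf : HasDerivAt (fun r => G (f r)) (G f') s := G.hasFDerivAt.comp_hasDerivAt s hf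
  have h := hGf.inner ℝ hf
  refine h.congr_deriv ?_
  rw [hGsym (f s) f', real_inner_comm]
  ring

/-- **SOURCE EXCLUSION along a backward orbit** (`Λ' < 1 + γ`).  Let `(V, P)` be a classical self-similar profile
(`V` smooth, `‖DV‖ ≤ K`), `G` a symmetric matrix with `⟪Gh, h⟫ ≥ g₀‖h‖²` (`g₀ > 0`), and `R` a bounded set on which
`⟪G (γh + DV(z)h), h⟫ ≤ Λ'⟪Gh, h⟫` for all `h` (adapted stretching of `DW = γI + DV` at most `Λ'`).  If the backward
orbit `Φ_s y`, `s ≤ 0`, stays in `R`, then `curl V (y) = 0`.  (At a hyperbolic source of `W` in the window such `G`,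
`Λ' < 1+γ` and a backward-invariant neighbourhood `R` always exist: `max Re λ(DW) < tr DW = 3γ < 1+γ`.)
[cite: ConstantinIgnatovaVicol2026Putative, §3.5 Thm 3.8 and Prop 3.9 (the mechanism, at a node)] -/
theorem curl_eq_zero_of_backward_orbit_stretching_lt (hV : ContDiff ℝ ∞ V) {K : ℝ} (hK : ∀ y, ‖fderiv ℝ V y‖ ≤ K)
    (hprof : IsSelfSimilarEulerProfile γ 0 V P)
    {G : EuclideanSpace ℝ (Fin 3) →L[ℝ] EuclideanSpace ℝ (Fin 3)}
    (hGsym : ∀ u v : EuclideanSpace ℝ (Fin 3), ⟪G u, v⟫ = ⟪u, G v⟫) {g₀ : ℝ} (hg₀ : 0 < g₀)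
    (hGpos : ∀ h : EuclideanSpace ℝ (Fin 3), g₀ * ‖h‖ ^ 2 ≤ ⟪G h, h⟫)
    {Λ' : ℝ} (hΛ : Λ' < 1 + γ) {R : Set (EuclideanSpace ℝ (Fin 3))} (hRb : Bornology.IsBounded R)
    (hstretch : ∀ z ∈ R, ∀ h : EuclideanSpace ℝ (Fin 3), ⟪G (γ • h + fderiv ℝ V z h), h⟫ ≤ Λ' * ⟪G h, h⟫)
    {y : EuclideanSpace ℝ (Fin 3)}
    (horbit : ∀ s : ℝ, s ≤ 0 → ODE.evolutionMap (fun _ : ℝ => selfSimilarTransport γ 0 V) 0 s y ∈ R) :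
    curl V y = 0 := by
  have hV2 : ContDiff ℝ 2 V := hV.of_le (by norm_cast)
  -- a bound for `Ω` on `R`
  obtain ⟨B, hB⟩ := hRb.subset_closedBall (0 : EuclideanSpace ℝ (Fin 3))
  obtain ⟨CΩ, hCΩ⟩ := (isCompact_closedBall (0 : EuclideanSpace ℝ (Fin 3)) B).exists_bound_of_continuousOn
    (differentiable_curl_of_contDiff hV2).continuous.continuousOn
  have hCΩ0 : 0 ≤ CΩ := (norm_nonneg _).trans (hCΩ _ (hB (horbit 0 le_rfl)))
  -- notation
  set v : EuclideanSpace ℝ (Fin 3) := curl V y with hv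
  set X : ℝ → EuclideanSpace ℝ (Fin 3) := fun r =>
    fderiv ℝ (ODE.evolutionMap (fun _ : ℝ => selfSimilarTransport γ 0 V) 0 r) y v with hX
  have hX' : ∀ t, HasDerivAt X (γ • X t +
      fderiv ℝ V (ODE.evolutionMap (fun _ : ℝ => selfSimilarTransport γ 0 V) 0 t y) (X t)) t := by
    intro t
    have h1 := (hasDerivAt_fderiv_flow (γ := γ) hV hK t y).clm_apply (hasDerivAt_const t v)
    simp only [map_zero, add_zero, ContinuousLinearMap.comp_apply, _root_.add_apply, _root_.smul_apply,
      ContinuousLinearMap.id_apply] at h1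
    exact h1
  -- `m(s) = ⟪G X s, X s⟫` and `m' ≤ 2 Λ' m` on `s ≤ 0`
  set m : ℝ → ℝ := fun r => ⟪G (X r), X r⟫ with hm
  have hm' : ∀ t, HasDerivAt m (2 * ⟪G (γ • X t +
      fderiv ℝ V (ODE.evolutionMap (fun _ : ℝ => selfSimilarTransport γ 0 V) 0 t y) (X t)), X t⟫) t :=
    fun t => hasDerivAt_adapted_sq hGsym (hX' t)
  have hm'le : ∀ t, t ≤ 0 → 2 * ⟪G (γ • X t +
      fderiv ℝ V (ODE.evolutionMap (fun _ : ℝ => selfSimilarTransport γ 0 V) 0 t y) (X t)), X t⟫ ≤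
      2 * Λ' * m t := by
    intro t ht
    have := hstretch _ (horbit t ht) (X t)
    show _ ≤ 2 * Λ' * ⟪G (X t), X t⟫
    linarith
  -- `F(s) = e^{−2Λ's} m(s)` is non-increasing on `(−∞, 0]`
  set F : ℝ → ℝ := fun r => Real.exp (-(2 * Λ') * r) * m r with hF
  have hF' : ∀ t, HasDerivAt F (Real.exp (-(2 * Λ') * t) * (-(2 * Λ')) * m t +
      Real.exp (-(2 * Λ') * t) * (2 * ⟪G (γ • X t +
        fderiv ℝ V (ODE.evolutionMap (fun _ : ℝ => selfSimilarTransport γ 0 V) 0 t y) (X t)), X t⟫)) t := by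
    intro t
    have hexp : HasDerivAt (fun r => Real.exp (-(2 * Λ') * r)) (Real.exp (-(2 * Λ') * t) * (-(2 * Λ'))) t := by
      simpa using ((hasDerivAt_id t).const_mul (-(2 * Λ'))).exp
    exact hexp.mul (hm' t)
  have hFanti : AntitoneOn F (Iic 0) := by
    have hFc : Continuous F := by
      have : ∀ t, HasDerivAt F _ t := hF'
      exact continuous_iff_continuousAt.2 fun t => (hF' t).continuousAt
    refine antitoneOn_of_hasDerivWithinAt_nonpos (convex_Iic 0) hFc.continuousOn
      (fun t _ => (hF' t).hasDerivWithinAt) fun t ht => ?_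
    rw [interior_Iic] at ht
    have h1 := hm'le t (le_of_lt ht)
    have hpos : 0 < Real.exp (-(2 * Λ') * t) := Real.exp_pos _
    nlinarith
  -- hence `e^{2Λ's} ⟪G v, v⟫ ≤ m(s)` for `s ≤ 0`
  have hΦ0 : ODE.evolutionMap (fun _ : ℝ => selfSimilarTransport γ 0 V) 0 0 = id :=
    funext (ODE.evolutionMap_self _ 0)
  have hm0 : m 0 = ⟪G v, v⟫ := by
    simp only [hm, hX, hΦ0, fderiv_id, ContinuousLinearMap.coe_id', id_eq]
  have hlow : ∀ s : ℝ, s ≤ 0 → Real.exp (2 * Λ' * s) * ⟪G v, v⟫ ≤ m s := by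
    intro s hs
    have h1 : F 0 ≤ F s := hFanti (mem_Iic.2 hs) (mem_Iic.2 le_rfl) hs
    simp only [hF, mul_zero, Real.exp_zero, one_mul] at h1
    rw [hm0] at h1
    have hexp : Real.exp (2 * Λ' * s) * Real.exp (-(2 * Λ') * s) = 1 := by
      rw [← Real.exp_add]; simp
    calc Real.exp (2 * Λ' * s) * ⟪G v, v⟫ ≤ Real.exp (2 * Λ' * s) * (Real.exp (-(2 * Λ') * s) * m s) :=
          mul_le_mul_of_nonneg_left h1 (Real.exp_pos _).le
      _ = m s := by rw [← mul_assoc, hexp, one_mul]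
  -- and `m(s) = e^{2(1+γ)s} ⟪G Ω(Φ_s y), Ω(Φ_s y)⟫ ≤ e^{2(1+γ)s} ‖G‖ CΩ²` by the Cauchy formula
  have hup : ∀ s : ℝ, s ≤ 0 → m s ≤ Real.exp (2 * (1 + γ) * s) * (‖G‖ * CΩ ^ 2) := by
    intro s hs
    have hc := cauchy_formula_flow hV hK hprof y s
    set w := curl V (ODE.evolutionMap (fun _ : ℝ => selfSimilarTransport γ 0 V) 0 s y) with hw
    have hwb : ‖w‖ ≤ CΩ := hCΩ _ (hB (horbit s hs))
    have hXs : X s = Real.exp ((1 + γ) * s) • w := hc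
    have e : m s = Real.exp ((1 + γ) * s) ^ 2 * ⟪G w, w⟫ := by
      show ⟪G (X s), X s⟫ = _
      rw [hXs, map_smul, real_inner_smul_left, real_inner_smul_right]
      ring
    have hGw : ⟪G w, w⟫ ≤ ‖G‖ * CΩ ^ 2 := by
      calc ⟪G w, w⟫ ≤ ‖G w‖ * ‖w‖ := real_inner_le_norm _ _
        _ ≤ ‖G‖ * ‖w‖ * ‖w‖ := mul_le_mul_of_nonneg_right (G.le_opNorm w) (norm_nonneg _)
        _ ≤ ‖G‖ * CΩ * CΩ := by
            have := mul_le_mul hwb hwb (norm_nonneg _) hCΩ0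
            nlinarith [norm_nonneg G, norm_nonneg w]
        _ = ‖G‖ * CΩ ^ 2 := by ring
    rw [e, ← Real.exp_nat_mul]
    push_cast
    rw [show (2 : ℝ) * ((1 + γ) * s) = 2 * (1 + γ) * s by ring]
    exact mul_le_mul_of_nonneg_left hGw (Real.exp_pos _).le
  -- conclusion: `g₀ ‖v‖² ≤ ‖G‖ CΩ² e^{2(1+γ−Λ')s}` for all `s ≤ 0`, so `v = 0`
  have hκ : 0 < 2 * (1 + γ - Λ') := by linarith
  have hkey : ∀ s : ℝ, s ≤ 0 → g₀ * ‖v‖ ^ 2 ≤ ‖G‖ * CΩ ^ 2 * Real.exp (2 * (1 + γ - Λ') * s) := by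
    intro s hs
    have h1 := (hlow s hs).trans (hup s hs)
    have hexp : Real.exp (2 * (1 + γ) * s) = Real.exp (2 * Λ' * s) * Real.exp (2 * (1 + γ - Λ') * s) := by
      rw [← Real.exp_add]; ring_nf
    rw [hexp] at h1
    have hpos : 0 < Real.exp (2 * Λ' * s) := Real.exp_pos _
    have h2 : ⟪G v, v⟫ ≤ Real.exp (2 * (1 + γ - Λ') * s) * (‖G‖ * CΩ ^ 2) := by
      have := h1
      rw [mul_assoc (Real.exp (2 * Λ' * s))] at this
      exact le_of_mul_le_mul_left this hpos
    calc g₀ * ‖v‖ ^ 2 ≤ ⟪G v, v⟫ := hGpos v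
      _ ≤ _ := h2
      _ = ‖G‖ * CΩ ^ 2 * Real.exp (2 * (1 + γ - Λ') * s) := by ring
  by_contra hne
  have hvpos : 0 < g₀ * ‖v‖ ^ 2 := by
    have : 0 < ‖v‖ := norm_pos_iff.2 hne
    positivity
  -- `e^{κ s} → 0` as `s → −∞`
  have hlim : Tendsto (fun s : ℝ => ‖G‖ * CΩ ^ 2 * Real.exp (2 * (1 + γ - Λ') * s)) atBot (𝓝 0) := by
    have h1 : Tendsto (fun s : ℝ => 2 * (1 + γ - Λ') * s) atBot atBot :=
      Tendsto.const_mul_atBot hκ tendsto_id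
    have h2 := Real.tendsto_exp_atBot.comp h1
    have h3 := h2.const_mul (‖G‖ * CΩ ^ 2)
    rw [mul_zero] at h3
    exact h3
  have hev := (hlim.eventually_lt_const hvpos).and (eventually_le_atBot (0 : ℝ))
  obtain ⟨s, hs1, hs2⟩ := hev.exists
  exact absurd (hkey s hs2) (not_le.2 hs1)

end Summit.NavierStokesRegularity.NavierStokesRegularity.Theorems.PowerGaugeEulerLiouville.Kelvin

end
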